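import Summits.Ventures.HodgeRepro2.T5SU11ImproperL2Iterates

/-!
# The Neumann series of the resolvent converges in `L²(sinh 2t dt)` at a geometric rate, on the class

For `λ, λ₂ > 1` and a source `g` of the exponentially decaying class at a rate `ε > 1`, row 503's Neumann expansion with
remainder, `G^I_λ g − Σ_{k=0}^{n} (μ − μ₂)^k (G^I_{λ₂})^{k+1} g = (μ − μ₂)^{n+1} G^I_λ (G^I_{λ₂})^{n+1} g`, with row 532's
sharp bound at `λ` and row 537's bound of the iterates at `λ₂`, gives

**`‖G^I_λ g − S_n‖² ≤ ((μ − μ₂)²/(λ₂ − 1)⁴)^{n+1} ‖g‖²/(λ − 1)⁴`** (`integral_sinh_mul_neumann_remainder_sq_le`),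

so that for `|μ − μ₂| < (λ₂ − 1)²` the partial sums `S_n` converge to `G^I_λ g` in `L²((0, ∞), sinh 2t dt)`
(`tendsto_neumann_l2`) — the `L²` form of row 506's pointwise Neumann series, with the explicit disc of convergence
`|μ − μ₂| < (λ₂ − 1)²` = the distance from `μ₂` to the bottom `−1 = −ρ²` of the continuous spectrum. Nothing is claimed
about (N).

Blind lane: Mathlib + the HodgeRepro2 prefix only; no sorry; axioms ⊆ {propext, Classical.choice,
Quot.sound}.
-/

namespace Summit.Ventures.HodgeRepro2.T5SU11ImproperL2Neumann

open Filter Topology MeasureTheory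
open Set (Ioi Ioc)
open T5SU11Cartan T5SU11SphericalFunction T5SU11SphericalDecay T5SU11RadialGreenImproper
  T5SU11RadialGreenImproperStable T5SU11ResolventNeumann T5SU11ImproperHardyClass T5SU11ImproperL2Iterates

section measure

variable [MeasurableSpace Circle] [BorelSpace Circle]

variable {lam lam₂ : ℝ} (hlam : 1 < lam) (hlam₂ : 1 < lam₂) {g : ℝ → ℝ} (hg : ContinuousOn g (Ioi 0))
  {M : ℝ} (hM : ∀ s ∈ Ioc (0 : ℝ) 1, |g s| ≤ M) (hM0 : 0 ≤ M)
  {ε C s₀ : ℝ} (hC : ∀ s, s₀ ≤ s → |g s| ≤ C * Real.exp (-ε * s)) (hε1 : 1 < ε)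

include hlam hlam₂ hg hM hM0 hC hε1 in
/-- **THE `L²` BOUND OF THE NEUMANN REMAINDER ON THE CLASS**:
`‖G^I_λ g − Σ_{k=0}^{n} (μ − μ₂)^k (G^I_{λ₂})^{k+1} g‖² ≤ ((μ − μ₂)²/((λ₂ − 1)²)²)^{n+1} ‖g‖²/((λ − 1)²)²`. -/
theorem integral_sinh_mul_neumann_remainder_sq_le (n : ℕ) :
    ∫ t in Ioi 0, Real.sinh (2 * t) * (greenSolI (fun t => sph lam (hyp t)) (sphDecay lam) g t
        - ∑ k ∈ Finset.range (n + 1), (lam * (lam - 2) - lam₂ * (lam₂ - 2)) ^ k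
          * (greenSolI (fun t => sph lam₂ (hyp t)) (sphDecay lam₂))^[k + 1] g t) ^ 2
      ≤ ((lam * (lam - 2) - lam₂ * (lam₂ - 2)) ^ 2 / ((lam₂ - 1) ^ 2) ^ 2) ^ (n + 1)
          * ((∫ t in Ioi 0, Real.sinh (2 * t) * g t ^ 2) / ((lam - 1) ^ 2) ^ 2) := by
  have hε : 2 - lam < ε := by linarith
  have hε₂ : 2 - lam₂ < ε := by linarith
  set κ := lam * (lam - 2) - lam₂ * (lam₂ - 2) with hκ
  set h := (greenSolI (fun t => sph lam₂ (hyp t)) (sphDecay lam₂))^[n + 1] g with hh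
  -- `h` is in the class at a rate `ε′ ∈ (1, min(ε, λ₂))`
  have hmin : 1 < min ε lam₂ := lt_min hε1 hlam₂
  set ε' := (1 + min ε lam₂) / 2 with hε'
  have hε'1 : 1 < ε' := by rw [hε']; linarith
  have hε'2 : ε' < min ε lam₂ := by rw [hε']; linarith
  have hε'lam : 2 - lam < ε' := by linarith
  obtain ⟨hcont, ⟨M', hM'0, hM'⟩, hdec⟩ := iterate_class hlam₂ hg hM hM0 hε₂ hC (n + 1)
  obtain ⟨K, T, _, _, hKT⟩ := hdec ε' hε'2
  -- the pointwise remainder identity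
  have e : (fun t => Real.sinh (2 * t) * (greenSolI (fun t => sph lam (hyp t)) (sphDecay lam) g t
        - ∑ k ∈ Finset.range (n + 1), κ ^ k * (greenSolI (fun t => sph lam₂ (hyp t)) (sphDecay lam₂))^[k + 1] g t) ^ 2)
      =ᵐ[volume.restrict (Ioi 0)] fun t => (κ ^ (n + 1)) ^ 2
        * (Real.sinh (2 * t) * greenSolI (fun t => sph lam (hyp t)) (sphDecay lam) h t ^ 2) := by
    refine ae_restrict_of_forall_mem measurableSet_Ioi (fun t ht => ?_)
    have := neumann_finite hlam hlam₂ hg hM hM0 hε hε₂ hC n (t := t) ht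
    beta_reduce
    rw [this]
    ring
  rw [MeasureTheory.integral_congr_ae e, MeasureTheory.integral_const_mul]
  -- the two sharp bounds
  have h1 := integral_sinh_mul_greenSolI_sq_le_all hlam hcont hM' hM'0 hε'lam hKT hε'1
  have h2 := integral_sinh_mul_iterate_sq_le hlam₂ hg hM hM0 hC hε1 (n + 1)
  have hp1 : 0 < ((lam - 1) ^ 2) ^ 2 := by
    have : 0 < lam - 1 := by linarith
    positivity
  have hp2 : 0 < (((lam₂ - 1) ^ 2) ^ 2) ^ (n + 1) := by
    have : 0 < lam₂ - 1 := by linarith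
    positivity
  calc (κ ^ (n + 1)) ^ 2 * ∫ t in Ioi 0, Real.sinh (2 * t) * greenSolI (fun t => sph lam (hyp t)) (sphDecay lam) h t ^ 2
      ≤ (κ ^ (n + 1)) ^ 2 * ((∫ t in Ioi 0, Real.sinh (2 * t) * h t ^ 2) / ((lam - 1) ^ 2) ^ 2) :=
        mul_le_mul_of_nonneg_left h1 (sq_nonneg _)
    _ ≤ (κ ^ (n + 1)) ^ 2 * (((∫ t in Ioi 0, Real.sinh (2 * t) * g t ^ 2) / (((lam₂ - 1) ^ 2) ^ 2) ^ (n + 1))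
          / ((lam - 1) ^ 2) ^ 2) :=
        mul_le_mul_of_nonneg_left (div_le_div_of_nonneg_right h2 hp1.le) (sq_nonneg _)
    _ = (κ ^ 2 / ((lam₂ - 1) ^ 2) ^ 2) ^ (n + 1) * ((∫ t in Ioi 0, Real.sinh (2 * t) * g t ^ 2) / ((lam - 1) ^ 2) ^ 2) := by
        have ha : ((lam - 1) ^ 2) ^ 2 ≠ 0 := hp1.ne'
        have hb : (((lam₂ - 1) ^ 2) ^ 2) ^ (n + 1) ≠ 0 := hp2.ne'
        rw [div_pow]
        field_simp
        ring

include hlam hlam₂ hg hM hM0 hC hε1 in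
/-- **THE NEUMANN SERIES CONVERGES IN `L²` ON THE CLASS** for `|μ − μ₂| < (λ₂ − 1)²`:
`‖G^I_λ g − Σ_{k=0}^{n} (μ − μ₂)^k (G^I_{λ₂})^{k+1} g‖² → 0` as `n → ∞` (at the geometric rate `(|μ − μ₂|/(λ₂ − 1)²)^{2(n+1)}`). -/
theorem tendsto_neumann_l2 (hq : |lam * (lam - 2) - lam₂ * (lam₂ - 2)| < (lam₂ - 1) ^ 2) :
    Tendsto (fun n : ℕ => ∫ t in Ioi 0, Real.sinh (2 * t) * (greenSolI (fun t => sph lam (hyp t)) (sphDecay lam) g t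
        - ∑ k ∈ Finset.range (n + 1), (lam * (lam - 2) - lam₂ * (lam₂ - 2)) ^ k
          * (greenSolI (fun t => sph lam₂ (hyp t)) (sphDecay lam₂))^[k + 1] g t) ^ 2) atTop (𝓝 0) := by
  set κ := lam * (lam - 2) - lam₂ * (lam₂ - 2) with hκ
  set q := κ ^ 2 / ((lam₂ - 1) ^ 2) ^ 2 with hq_def
  have hb : 0 < ((lam₂ - 1) ^ 2) ^ 2 := by
    have : 0 < lam₂ - 1 := by linarith
    positivity
  have hq0 : 0 ≤ q := by positivity
  have hq1 : q < 1 := by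
    rw [hq_def, div_lt_one hb]
    have := pow_lt_pow_left₀ hq (abs_nonneg _) two_ne_zero
    rwa [sq_abs] at this
  set Kc := (∫ t in Ioi 0, Real.sinh (2 * t) * g t ^ 2) / ((lam - 1) ^ 2) ^ 2 with hKc
  have hlim : Tendsto (fun n : ℕ => q ^ (n + 1) * Kc) atTop (𝓝 0) := by
    have h := ((tendsto_pow_atTop_nhds_zero_of_lt_one hq0 hq1).comp (tendsto_add_atTop_nat 1)).mul_const Kc
    rwa [zero_mul] at h
  refine squeeze_zero (fun n => ?_) (fun n => integral_sinh_mul_neumann_remainder_sq_le hlam hlam₂ hg hM hM0 hC hε1 n) hlim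
  apply setIntegral_nonneg measurableSet_Ioi
  intro t ht
  have ht0 : 0 < t := ht
  exact mul_nonneg (Real.sinh_nonneg_iff.mpr (by linarith)) (sq_nonneg _)

end measure

end Summit.Ventures.HodgeRepro2.T5SU11ImproperL2Neumann
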